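import Mathlib
import Summits.ValiantsHypothesis.ValiantsHypothesis.Theorems.RigidityForcesSymmetryRankRigidMinimalReprLaplaceDefs
import Summits.ValiantsHypothesis.ValiantsHypothesis.Theorems.RigidityForcesSymmetryRankRigidMinimalReprLaplaceFourDefs
import Summits.ValiantsHypothesis.ValiantsHypothesis.Theorems.RigidityForcesSymmetryRankRigidMinimalReprLaplaceFourContraction
import Summits.ValiantsHypothesis.ValiantsHypothesis.Theorems.RigidityForcesSymmetryRankRigidMinimalReprLaplaceFourSlices
import Summits.ValiantsHypothesis.ValiantsHypothesis.Theorems.RigidityForcesSymmetryRankRigidMinimalReprLaplaceFourFlat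
import Summits.ValiantsHypothesis.ValiantsHypothesis.Theorems.RigidityForcesSymmetryRankRigidMinimalReprLaplaceFourLinePsi
import Summits.ValiantsHypothesis.ValiantsHypothesis.Theorems.RigidityForcesSymmetryRankRigidMinimalReprLaplaceFourProfile311
import Summits.ValiantsHypothesis.ValiantsHypothesis.Theorems.RigidityForcesSymmetryRankRigidMinimalReprLaplaceFourProfile211s
import Summits.ValiantsHypothesis.ValiantsHypothesis.Theorems.RigidityForcesSymmetryRankRigidMinimalReprLaplaceFourProfile410

/-!
# `LaplaceOptimal 4`: array forms of the profiles (assembly, part 1)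
# (crux `RankRigidMinimalRepr`, stmt-ValiantsHypothesis-18034, route `RigidityForcesSymmetry`)

Bridges between the data format of `LaplaceOptimal 4` (split terms indexed by a `Finset`, dependence sets `S_t`) and
the array forms in which the profiles `(3,1,1)`, `slice+(2,1,1)`, `(4,1,0)` (and `(2,2,1)`) are refuted:
* `pad_sum`: a sum over a `Finset` of cardinality `≤ k` is a sum over `Fin k` of the same summands padded by zeros;
* `arrays_slice0 / _pair01 / _pair02 / _pair03`: a split term across `{0} / {0,1} / {0,2} / {0,3}` is
  `f(v₀)H(v₁,v₂,v₃) / g(v₀,v₁)h(v₂,v₃) / b(v₀,v₂)b′(v₁,v₃) / c(v₀,v₃)c′(v₁,v₂)`;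
* `arrays_of_profile`: a decomposition of `P₄` with types in `{ {0}, {0,1}, {0,2}, {0,3} }` and bounded multiplicities
  is a decomposition in array form with `Fin kᵢ`-indexed families;
* `profile_311_fin`, `profile_211s_fin`, `profile_410_fin`: the `Finset` forms of the three array theorems.

HONEST FRAMING: bookkeeping toward `LaplaceOptimal 4` (rung `TiedTorusBound 3`); the crux stays OPEN; nothing here
bears on `VP ≠ VNP`.
-/

set_option autoImplicit false

-- the mandated summit-side namespace repeats a component by design (single-problem summit)
set_option linter.dupNamespace false

namespace Summit.ValiantsHypothesis.ValiantsHypothesis.Theorems.RigidityForcesSymmetryRankRigidMinimalRepr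

namespace LaplaceFourLine

open Matrix LaplaceFourContraction

/-! ### §1 Padding and array forms -/

/-- A sum over a `Finset` of cardinality `≤ k` is a sum over `Fin k` of the same summands, padded by zeros. -/
theorem pad_sum {ι : Type*} {M : Type*} [AddCommMonoid M] (Φ : ι → M) :
    ∀ (k : ℕ) (s : Finset ι), s.card ≤ k →
      ∃ Φ' : Fin k → M, (∑ t ∈ s, Φ t = ∑ i, Φ' i) ∧ ∀ i, Φ' i = 0 ∨ ∃ t ∈ s, Φ' i = Φ t := by
  classical
  intro k s
  induction s using Finset.induction_on generalizing k with
  | empty => intro _; exact ⟨fun _ => 0, by simp, fun _ => Or.inl rfl⟩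
  | insert a s ha ih =>
    intro hk
    rw [Finset.card_insert_of_notMem ha] at hk
    obtain ⟨k', rfl⟩ : ∃ k', k = k' + 1 := ⟨k - 1, by omega⟩
    obtain ⟨Φ'', h1, h2⟩ := ih k' (by omega)
    refine ⟨Fin.cons (Φ a) Φ'', ?_, fun i => Fin.cases ?_ (fun j => ?_) i⟩
    · rw [Finset.sum_insert ha, h1, Fin.sum_univ_succ]
      simp only [Fin.cons_zero, Fin.cons_succ]
    · exact Or.inr ⟨a, Finset.mem_insert_self a s, by simp⟩
    · rcases h2 j with h | ⟨t, ht, h⟩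
      · exact Or.inl (by simp [h])
      · exact Or.inr ⟨t, Finset.mem_insert_of_mem ht, by simp [h]⟩

/-- A split term across `{0}` in array form. -/
theorem arrays_slice0 {X : (Fin 4 → Fin 4) → ℂ} (hX : IsSplitTerm {0} X) :
    ∃ (f : Fin 4 → ℂ) (H : Fin 4 → Fin 4 → Fin 4 → ℂ), ∀ v, X v = f (v 0) * H (v 1) (v 2) (v 3) := by
  obtain ⟨u, w, hu, hw, hX⟩ := hX
  refine ⟨fun x => u ![x, 0, 0, 0], fun y z t => w ![0, y, z, t], fun v => ?_⟩
  rw [hX v, hu v ![v 0, 0, 0, 0] (fun i hi => by simp at hi; subst hi; rfl),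
    hw v ![0, v 1, v 2, v 3] (fun i hi => by
      fin_cases i <;> simp_all)]

/-- A split term across `{0,1}` in array form. -/
theorem arrays_pair01 {X : (Fin 4 → Fin 4) → ℂ} (hX : IsSplitTerm {0, 1} X) :
    ∃ g h : Fin 4 → Fin 4 → ℂ, ∀ v, X v = g (v 0) (v 1) * h (v 2) (v 3) := by
  obtain ⟨u, w, hu, hw, hX⟩ := hX
  refine ⟨fun x y => u ![x, y, 0, 0], fun z t => w ![0, 0, z, t], fun v => ?_⟩
  rw [hX v, hu v ![v 0, v 1, 0, 0] (fun i hi => by fin_cases i <;> simp_all),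
    hw v ![0, 0, v 2, v 3] (fun i hi => by fin_cases i <;> simp_all)]

/-- A split term across `{0,2}` in array form. -/
theorem arrays_pair02 {X : (Fin 4 → Fin 4) → ℂ} (hX : IsSplitTerm {0, 2} X) :
    ∃ b b' : Fin 4 → Fin 4 → ℂ, ∀ v, X v = b (v 0) (v 2) * b' (v 1) (v 3) := by
  obtain ⟨u, w, hu, hw, hX⟩ := hX
  refine ⟨fun x z => u ![x, 0, z, 0], fun y t => w ![0, y, 0, t], fun v => ?_⟩
  rw [hX v, hu v ![v 0, 0, v 2, 0] (fun i hi => by fin_cases i <;> simp_all),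
    hw v ![0, v 1, 0, v 3] (fun i hi => by fin_cases i <;> simp_all)]

/-- A split term across `{0,3}` in array form. -/
theorem arrays_pair03 {X : (Fin 4 → Fin 4) → ℂ} (hX : IsSplitTerm {0, 3} X) :
    ∃ c c' : Fin 4 → Fin 4 → ℂ, ∀ v, X v = c (v 0) (v 3) * c' (v 1) (v 2) := by
  obtain ⟨u, w, hu, hw, hX⟩ := hX
  refine ⟨fun x t => u ![x, 0, 0, t], fun y z => w ![0, y, z, 0], fun v => ?_⟩
  rw [hX v, hu v ![v 0, 0, 0, v 3] (fun i hi => by fin_cases i <;> simp_all),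
    hw v ![0, v 1, v 2, 0] (fun i hi => by fin_cases i <;> simp_all)]

/-- **Array form of a profile.**  A decomposition of `P₄` into split terms of the types `{0}`, `{0,1}`, `{0,2}`, `{0,3}`
with multiplicities at most `k₀, k₁, k₂, k₃` is a decomposition in array form with `Fin kᵢ`-indexed families. -/
theorem arrays_of_profile {ι : Type*} (T : Finset ι) (X : ι → (Fin 4 → Fin 4) → ℂ) (S : ι → Finset (Fin 4))
    (hX : ∀ t ∈ T, IsSplitTerm (S t) (X t))
    (hS : ∀ t ∈ T, S t = {0} ∨ S t = {0, 1} ∨ S t = {0, 2} ∨ S t = {0, 3})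
    (k₀ k₁ k₂ k₃ : ℕ) (h₀ : (T.filter fun t => S t = {0}).card ≤ k₀) (h₁ : (T.filter fun t => S t = {0, 1}).card ≤ k₁)
    (h₂ : (T.filter fun t => S t = {0, 2}).card ≤ k₂) (h₃ : (T.filter fun t => S t = {0, 3}).card ≤ k₃)
    (hsum : ∀ v, permPattern₄ v = ∑ t ∈ T, X t v) :
    ∃ (f : Fin k₀ → Fin 4 → ℂ) (H : Fin k₀ → Fin 4 → Fin 4 → Fin 4 → ℂ) (g h : Fin k₁ → Fin 4 → Fin 4 → ℂ)
      (b b' : Fin k₂ → Fin 4 → Fin 4 → ℂ) (c c' : Fin k₃ → Fin 4 → Fin 4 → ℂ), ∀ v, permPattern₄ v =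
      (∑ i, f i (v 0) * H i (v 1) (v 2) (v 3)) + (∑ i, g i (v 0) (v 1) * h i (v 2) (v 3)) +
        (∑ i, b i (v 0) (v 2) * b' i (v 1) (v 3)) + ∑ i, c i (v 0) (v 3) * c' i (v 1) (v 2) := by
  classical
  -- split the sum by type
  have hsplit : ∀ v, ∑ t ∈ T, X t v = (∑ t ∈ T.filter (fun t => S t = {0}), X t v) +
      (∑ t ∈ T.filter (fun t => S t = {0, 1}), X t v) + (∑ t ∈ T.filter (fun t => S t = {0, 2}), X t v) +
      ∑ t ∈ T.filter (fun t => S t = {0, 3}), X t v := by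
    intro v
    have hT : T = T.filter (fun t => S t = {0}) ∪ T.filter (fun t => S t = {0, 1}) ∪
        T.filter (fun t => S t = {0, 2}) ∪ T.filter (fun t => S t = {0, 3}) := by
      ext t
      simp only [Finset.mem_union, Finset.mem_filter]
      constructor
      · intro ht; rcases hS t ht with h | h | h | h <;> simp [ht, h]
      · rintro (((⟨ht, -⟩ | ⟨ht, -⟩) | ⟨ht, -⟩) | ⟨ht, -⟩) <;> exact ht
    have d01 : ({0} : Finset (Fin 4)) ≠ {0, 1} := by decide
    have d02 : ({0} : Finset (Fin 4)) ≠ {0, 2} := by decide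
    have d03 : ({0} : Finset (Fin 4)) ≠ {0, 3} := by decide
    have d12 : ({0, 1} : Finset (Fin 4)) ≠ {0, 2} := by decide
    have d13 : ({0, 1} : Finset (Fin 4)) ≠ {0, 3} := by decide
    have d23 : ({0, 2} : Finset (Fin 4)) ≠ {0, 3} := by decide
    conv_lhs => rw [hT]
    rw [Finset.sum_union, Finset.sum_union, Finset.sum_union]
    · rw [Finset.disjoint_filter]; intro t _ h; rw [h]; exact d01
    · rw [Finset.disjoint_union_left]
      exact ⟨by rw [Finset.disjoint_filter]; intro t _ h; rw [h]; exact d02,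
        by rw [Finset.disjoint_filter]; intro t _ h; rw [h]; exact d12⟩
    · rw [Finset.disjoint_union_left, Finset.disjoint_union_left]
      exact ⟨⟨by rw [Finset.disjoint_filter]; intro t _ h; rw [h]; exact d03,
        by rw [Finset.disjoint_filter]; intro t _ h; rw [h]; exact d13⟩,
        by rw [Finset.disjoint_filter]; intro t _ h; rw [h]; exact d23⟩
  -- pad each part
  obtain ⟨F₀, hF₀, hF₀'⟩ := pad_sum X k₀ _ h₀
  obtain ⟨F₁, hF₁, hF₁'⟩ := pad_sum X k₁ _ h₁
  obtain ⟨F₂, hF₂, hF₂'⟩ := pad_sum X k₂ _ h₂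
  obtain ⟨F₃, hF₃, hF₃'⟩ := pad_sum X k₃ _ h₃
  -- array forms of the padded summands
  have A₀ : ∀ i, ∃ (f : Fin 4 → ℂ) (H : Fin 4 → Fin 4 → Fin 4 → ℂ), ∀ v, F₀ i v = f (v 0) * H (v 1) (v 2) (v 3) := by
    intro i
    rcases hF₀' i with h | ⟨t, ht, h⟩
    · exact ⟨0, 0, fun v => by simp [h]⟩
    · rw [Finset.mem_filter] at ht
      obtain ⟨f, H, hf⟩ := arrays_slice0 (ht.2 ▸ hX t ht.1)
      exact ⟨f, H, fun v => by rw [h]; exact hf v⟩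
  have A₁ : ∀ i, ∃ g h : Fin 4 → Fin 4 → ℂ, ∀ v, F₁ i v = g (v 0) (v 1) * h (v 2) (v 3) := by
    intro i
    rcases hF₁' i with h | ⟨t, ht, h⟩
    · exact ⟨0, 0, fun v => by simp [h]⟩
    · rw [Finset.mem_filter] at ht
      obtain ⟨g, h', hg⟩ := arrays_pair01 (ht.2 ▸ hX t ht.1)
      exact ⟨g, h', fun v => by rw [h]; exact hg v⟩
  have A₂ : ∀ i, ∃ b b' : Fin 4 → Fin 4 → ℂ, ∀ v, F₂ i v = b (v 0) (v 2) * b' (v 1) (v 3) := by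
    intro i
    rcases hF₂' i with h | ⟨t, ht, h⟩
    · exact ⟨0, 0, fun v => by simp [h]⟩
    · rw [Finset.mem_filter] at ht
      obtain ⟨b, b', hb⟩ := arrays_pair02 (ht.2 ▸ hX t ht.1)
      exact ⟨b, b', fun v => by rw [h]; exact hb v⟩
  have A₃ : ∀ i, ∃ c c' : Fin 4 → Fin 4 → ℂ, ∀ v, F₃ i v = c (v 0) (v 3) * c' (v 1) (v 2) := by
    intro i
    rcases hF₃' i with h | ⟨t, ht, h⟩
    · exact ⟨0, 0, fun v => by simp [h]⟩
    · rw [Finset.mem_filter] at ht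
      obtain ⟨c, c', hc⟩ := arrays_pair03 (ht.2 ▸ hX t ht.1)
      exact ⟨c, c', fun v => by rw [h]; exact hc v⟩
  choose f H hfH using A₀
  choose g h hgh using A₁
  choose b b' hbb using A₂
  choose c c' hcc using A₃
  refine ⟨f, H, g, h, b, b', c, c', fun v => ?_⟩
  rw [hsum v, hsplit v]
  have e₀ := congrFun hF₀ v
  have e₁ := congrFun hF₁ v
  have e₂ := congrFun hF₂ v
  have e₃ := congrFun hF₃ v
  simp only [Finset.sum_apply] at e₀ e₁ e₂ e₃
  rw [e₀, e₁, e₂, e₃]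
  simp only [hfH, hgh, hbb, hcc]

/-! ### §2 The profiles `(3,1,1)`, `slice+(2,1,1)`, `(4,1,0)` in the `Finset` format -/

/-- The profile `(3,1,1)` in the `Finset` format. -/
theorem profile_311_fin {ι : Type*} (T : Finset ι) (X : ι → (Fin 4 → Fin 4) → ℂ) (S : ι → Finset (Fin 4))
    (hX : ∀ t ∈ T, IsSplitTerm (S t) (X t)) (hS : ∀ t ∈ T, S t = {0, 1} ∨ S t = {0, 2} ∨ S t = {0, 3})
    (h₁ : (T.filter fun t => S t = {0, 1}).card ≤ 3) (h₂ : (T.filter fun t => S t = {0, 2}).card ≤ 1)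
    (h₃ : (T.filter fun t => S t = {0, 3}).card ≤ 1) (hsum : ∀ v, permPattern₄ v = ∑ t ∈ T, X t v) : False := by
  classical
  have h₀ : (T.filter fun t => S t = {0}).card ≤ 0 := by
    rw [Nat.le_zero, Finset.card_eq_zero, Finset.filter_eq_empty_iff]
    intro t ht h0
    rcases hS t ht with h | h | h <;> rw [h0] at h <;> exact absurd h (by decide)
  obtain ⟨f, H, g, h, b, b', c, c', hP⟩ :=
    arrays_of_profile T X S hX (fun t ht => Or.inr (hS t ht)) 0 3 1 1 h₀ h₁ h₂ h₃ hsum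
  refine profile_311 g h (b 0) (b' 0) (c 0) (c' 0) fun v => ?_
  rw [hP v]
  simp

/-- The profile `slice+(2,1,1)` in the `Finset` format. -/
theorem profile_211s_fin {ι : Type*} (T : Finset ι) (X : ι → (Fin 4 → Fin 4) → ℂ) (S : ι → Finset (Fin 4))
    (hX : ∀ t ∈ T, IsSplitTerm (S t) (X t)) (hS : ∀ t ∈ T, S t = {0} ∨ S t = {0, 1} ∨ S t = {0, 2} ∨ S t = {0, 3})
    (h₀ : (T.filter fun t => S t = {0}).card ≤ 1) (h₁ : (T.filter fun t => S t = {0, 1}).card ≤ 2)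
    (h₂ : (T.filter fun t => S t = {0, 2}).card ≤ 1) (h₃ : (T.filter fun t => S t = {0, 3}).card ≤ 1)
    (hsum : ∀ v, permPattern₄ v = ∑ t ∈ T, X t v) : False := by
  classical
  obtain ⟨f, H, g, h, b, b', c, c', hP⟩ := arrays_of_profile T X S hX hS 1 2 1 1 h₀ h₁ h₂ h₃ hsum
  refine profile_211s (f 0) (H 0) (g 0) (h 0) (g 1) (h 1) (b 0) (b' 0) (c 0) (c' 0) fun v => ?_
  rw [hP v]
  simp [Fin.sum_univ_two, add_assoc]

/-- The profile `(4,1,0)` in the `Finset` format. -/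
theorem profile_410_fin {ι : Type*} (T : Finset ι) (X : ι → (Fin 4 → Fin 4) → ℂ) (S : ι → Finset (Fin 4))
    (hX : ∀ t ∈ T, IsSplitTerm (S t) (X t)) (hS : ∀ t ∈ T, S t = {0, 1} ∨ S t = {0, 2})
    (h₁ : (T.filter fun t => S t = {0, 1}).card ≤ 4) (h₂ : (T.filter fun t => S t = {0, 2}).card ≤ 1)
    (hsum : ∀ v, permPattern₄ v = ∑ t ∈ T, X t v) : False := by
  classical
  have h₀ : (T.filter fun t => S t = {0}).card ≤ 0 := by
    rw [Nat.le_zero, Finset.card_eq_zero, Finset.filter_eq_empty_iff]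
    intro t ht h0
    rcases hS t ht with h | h <;> rw [h0] at h <;> exact absurd h (by decide)
  have h₃ : (T.filter fun t => S t = {0, 3}).card ≤ 0 := by
    rw [Nat.le_zero, Finset.card_eq_zero, Finset.filter_eq_empty_iff]
    intro t ht h0
    rcases hS t ht with h | h <;> rw [h0] at h <;> exact absurd h (by decide)
  obtain ⟨f, H, g, h, b, b', c, c', hP⟩ :=
    arrays_of_profile T X S hX (fun t ht => Or.inr (by rcases hS t ht with h | h <;> simp [h])) 0 4 1 0 h₀ h₁ h₂ h₃ hsum
  refine profile_410 g h (b 0) (b' 0) fun v => ?_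
  rw [hP v]
  simp

end LaplaceFourLine

end Summit.ValiantsHypothesis.ValiantsHypothesis.Theorems.RigidityForcesSymmetryRankRigidMinimalRepr
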